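import Summits.ValiantsHypothesis.ValiantsHypothesis.Theorems.DefinabilityGapShiftedPrimes
import HarnessLib

/-!
# DefinabilityGap — the TWO-TERM (unique-factorisation) rung of the planted KI generator: degree-free, support-free

Route `route-ValiantsHypothesis-DefinabilityGap` (decomp-valiant cycle 1, lens 5: hardness–randomness / PIT axis), census
cells F4 / W10 (`KIPlantedHittingRO`, stmt-ValiantsHypothesis-23704, the any-order read-once leaf) and W5 (structure of the
annihilator ideal of `G_m`), filed `--supports` the residual `KIPlantedHitting` (stmt-ValiantsHypothesis-23547).

Every rung landed so far for `G_m : y ↦ (per_m(y|S_c))_{c ∈ 𝔽_q³}` caps the DEGREE (`kiPer_hits_affine`, `…_degree_le_two`,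
`kiPer_hits_degree_le_q`, `eventually_kiPer_hits_degree_le_mul`), the SUPPORT (`kiPer_hits_support`, `kiPer_hits_linear`) or
the SIZE below `m²/4` — and annihilators of degree `≤ q²` exist (`DefinabilityGapDegreeRoadCeiling`). This file proves the
first hitting statement with NO cap on degree, support or size, the bottom rung of the WIDTH ladder of the read-once leaf:

* (from `DefinabilityGapShiftedPrimes`) every `P_c − α := per_m(y|S_c) − α` is a PRIME of `ℂ[y]` (`per_n − a` is
  irreducible: von zur Gathen's argument run for the shifted permanent), two of them are associated only when
  `(c, α) = (c', α')` (`m ≥ 3`), and each `P_c` is transcendental.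
* `emultiplicity_kiPer_sub_C_aeval`: the `(P_{c₀} − α)`-adic valuation of `h(P_c)` (`h ∈ ℂ[X]`, `h ≠ 0`) is the root
  multiplicity of `α` in `h` if `c = c₀` and `0` otherwise.
* MAIN THEOREM `kiPer_hits_prod_sub_prod` (`m ≥ 3`): `G_m` hits every nonzero
  `D = ∏_{c ∈ S} f_c(z_c) − ∏_{c ∈ S} g_c(z_c)` (`f_c, g_c ∈ ℂ[X]` arbitrary univariates — any degree, any block set `S`, up
  to all `q³` blocks): comparing valuations of `D(G_m) = 0` at every prime `P_c − α` forces `f_c` and `g_c` to have the same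
  roots with multiplicity, whence `D = 0`. Equivalently (`kiPer_hits_prod_add_prod`) `G_m` hits every nonzero sum of two
  products of univariates (`Σ^{[2]}Π`-univariate = the width-2 read-once oblivious ABPs with DIAGONAL transition matrices,
  in ANY order of the `q³` variables), in particular
* `kiPer_hits_binomial` / `three_le_card_support_of_annihilator`: NO binomial `a·z^κ − b·z^{κ'}` annihilates `G_m` (no
  toric relation among the `q³` block permanents); every annihilator of `G_m` has at least THREE monomials (all `m ≥ 3`;
  sharp in `m`: at `m = 2` the second differences `P_a − P_b − P_c + P_d` vanish).

Placement. Any `D` with SOME monomial on few blocks (`< ½·m²·ln(m / ln 64m⁶)` of them, e.g. every sum of univariates) is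
already hit by the alien-exclusion road (`kiPer_hits_of_refined`); the content here is the deep regime where every monomial
of `D` reads `> k·q` blocks — exactly where the annihilators of degree `≤ q²` live. Width 1 (one product of univariates) is
hit because `ℂ[y]` is a domain; two terms is this file (UFD); three terms is where unique factorisation stops deciding and
S-unit / Mason–Stothers bounds only constrain multiplicities; the full (non-diagonal) width-2 read-once case reduces (lens-5
notes, g17) to the field-intersection property `ℂ(P_A) ∩ ℂ(P_B) = ℂ` across the cuts of the order — a birational, not a
matroidal, invariant of `G_m`; open. 0 sorry.
-/

noncomputable section

open MvPolynomial
open scoped Polynomial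
open Literature.Computability.AlgebraicComplexity Literature.Computability.MetaComplexity

namespace Summit.ValiantsHypothesis.ValiantsHypothesis.Theorems.DefinabilityGapTwoTermRung

open Summit.ValiantsHypothesis.ValiantsHypothesis.Theorems.DefinabilityGapAffineRung
open Summit.ValiantsHypothesis.ValiantsHypothesis.Theorems.DefinabilityGapSupportRung
open Summit.ValiantsHypothesis.ValiantsHypothesis.Theorems.DefinabilityGapShiftedPrimes

variable {m : ℕ}


/-! ## 1. Valuations of univariates evaluated at block permanents -/

/-- The valuation of one shifted block permanent at another: `v_{P_{c₀} − α}(P_c − β) = [c₀ = c ∧ α = β]`. [this file] -/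
theorem emultiplicity_kiPer_sub_C_kiPer_sub_C (hm : 3 ≤ m) (c₀ c : Fin 3 → Fin (qOf m)) (α β : ℂ) :
    emultiplicity (kiPer m c₀ - C α) (kiPer m c - C β) = if c₀ = c ∧ α = β then 1 else 0 := by
  have h1 : 1 ≤ m := by omega
  have hp : Prime (kiPer m c₀ - C α) := kiPer_sub_C_prime h1 c₀ α
  split_ifs with h
  · obtain ⟨rfl, rfl⟩ := h
    exact (FiniteMultiplicity.of_prime_left hp hp.ne_zero).emultiplicity_self
  · exact emultiplicity_eq_zero.2 fun hd => h ((kiPer_sub_C_dvd_iff hm).1 hd)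

/-- … and of its powers. [this file] -/
theorem emultiplicity_kiPer_sub_C_pow (hm : 3 ≤ m) (c₀ c : Fin 3 → Fin (qOf m)) (α β : ℂ) (k : ℕ) :
    emultiplicity (kiPer m c₀ - C α) ((kiPer m c - C β) ^ k) = if c₀ = c ∧ α = β then (k : ℕ∞) else 0 := by
  have h1 : 1 ≤ m := by omega
  rw [emultiplicity_pow (kiPer_sub_C_prime h1 c₀ α), emultiplicity_kiPer_sub_C_kiPer_sub_C hm]
  split_ifs <;> simp

/-- Over `ℂ`, `h = lead(h) · ∏_{β ∈ roots} (X − β)`. [folklore] -/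
theorem C_leadingCoeff_mul_rootsProd (h : ℂ[X]) :
    Polynomial.C h.leadingCoeff * (h.roots.map fun a => Polynomial.X - Polynomial.C a).prod = h :=
  Polynomial.C_leadingCoeff_mul_prod_multiset_X_sub_C (IsAlgClosed.card_roots_eq_natDegree)

/-- Evaluating the root product at a point `x` of a `ℂ`-algebra: `∏_{β} (x − β)^{mult β}`. [folklore] -/
theorem aeval_rootsProd {A : Type*} [CommRing A] [Algebra ℂ A] (x : A) (h : ℂ[X]) :
    Polynomial.aeval x (h.roots.map fun a => Polynomial.X - Polynomial.C a).prod =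
      ∏ β ∈ h.roots.toFinset, (x - algebraMap ℂ A β) ^ h.roots.count β := by
  classical
  rw [map_multiset_prod, Multiset.map_map, Finset.prod_multiset_map_count]
  refine Finset.prod_congr rfl fun β _ => ?_
  simp [Function.comp]

/-- Evaluating `h` at `x`: `h(x) = lead(h) · ∏_{β} (x − β)^{mult β}`. [folklore] -/
theorem aeval_eq_leadingCoeff_mul_prod {A : Type*} [CommRing A] [Algebra ℂ A] (x : A) (h : ℂ[X]) :
    Polynomial.aeval x h =
      algebraMap ℂ A h.leadingCoeff * ∏ β ∈ h.roots.toFinset, (x - algebraMap ℂ A β) ^ h.roots.count β := by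
  conv_lhs => rw [← C_leadingCoeff_mul_rootsProd h]
  rw [map_mul, Polynomial.aeval_C, aeval_rootsProd]

/-- **The `(P_{c₀} − α)`-adic valuation of `h(P_c)`** (`h ≠ 0`, `m ≥ 3`): the root multiplicity of `α` in `h` if
`c = c₀`, and `0` otherwise. [this file] -/
theorem emultiplicity_kiPer_sub_C_aeval (hm : 3 ≤ m) (c₀ c : Fin 3 → Fin (qOf m)) (α : ℂ) {h : ℂ[X]}
    (hh : h ≠ 0) :
    emultiplicity (kiPer m c₀ - C α) (Polynomial.aeval (kiPer m c) h) =
      if c = c₀ then (h.rootMultiplicity α : ℕ∞) else 0 := by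
  classical
  have h1 : 1 ≤ m := by omega
  have hp : Prime (kiPer m c₀ - C α) := kiPer_sub_C_prime h1 c₀ α
  rw [aeval_eq_leadingCoeff_mul_prod, emultiplicity_mul hp, Finset.emultiplicity_prod hp]
  have hunit : IsUnit (algebraMap ℂ (MvPolynomial (Fin (qOf m) × Fin (qOf m)) ℂ) h.leadingCoeff) :=
    (IsUnit.mk0 _ (Polynomial.leadingCoeff_ne_zero.2 hh)).map _
  rw [emultiplicity_eq_zero.2 fun hd => hp.not_unit (isUnit_of_dvd_unit hd hunit), zero_add]
  simp only [MvPolynomial.algebraMap_eq]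
  simp_rw [emultiplicity_kiPer_sub_C_pow hm]
  by_cases hc : c = c₀
  · subst hc
    rw [if_pos rfl]
    simp only [true_and]
    rw [Finset.sum_ite_eq]
    split_ifs with hmem
    · rw [Polynomial.count_roots]
    · rw [Multiset.mem_toFinset] at hmem
      rw [← Polynomial.count_roots, Multiset.count_eq_zero_of_notMem hmem]
      simp
  · rw [if_neg hc]
    exact Finset.sum_eq_zero fun β _ => if_neg fun h' => hc h'.1.symm

/-- **Valuation of a product of univariates at block permanents**: only the block `c₀` contributes. [this file] -/
theorem emultiplicity_kiPer_sub_C_prod_aeval (hm : 3 ≤ m) (S : Finset (Fin 3 → Fin (qOf m)))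
    {f : (Fin 3 → Fin (qOf m)) → ℂ[X]} (hf : ∀ c ∈ S, f c ≠ 0) (c₀ : Fin 3 → Fin (qOf m)) (α : ℂ) :
    emultiplicity (kiPer m c₀ - C α) (∏ c ∈ S, Polynomial.aeval (kiPer m c) (f c)) =
      if c₀ ∈ S then ((f c₀).rootMultiplicity α : ℕ∞) else 0 := by
  classical
  have h1 : 1 ≤ m := by omega
  rw [Finset.emultiplicity_prod (kiPer_sub_C_prime h1 c₀ α)]
  rw [Finset.sum_congr rfl fun c hc => emultiplicity_kiPer_sub_C_aeval hm c₀ c α (hf c hc)]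
  exact Finset.sum_ite_eq' S c₀ _

/-! ## 2. The two-term rung -/

/-- Equal products at `G_m` force equal root multiplicities block by block. [this file] -/
theorem rootMultiplicity_eq_of_prod_aeval_eq (hm : 3 ≤ m) {S : Finset (Fin 3 → Fin (qOf m))}
    {f g : (Fin 3 → Fin (qOf m)) → ℂ[X]} (hf : ∀ c ∈ S, f c ≠ 0) (hg : ∀ c ∈ S, g c ≠ 0)
    (h : ∏ c ∈ S, Polynomial.aeval (kiPer m c) (f c) = ∏ c ∈ S, Polynomial.aeval (kiPer m c) (g c))
    {c₀ : Fin 3 → Fin (qOf m)} (hc₀ : c₀ ∈ S) (α : ℂ) :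
    (f c₀).rootMultiplicity α = (g c₀).rootMultiplicity α := by
  have e1 := emultiplicity_kiPer_sub_C_prod_aeval hm S hf c₀ α
  have e2 := emultiplicity_kiPer_sub_C_prod_aeval hm S hg c₀ α
  rw [h, if_pos hc₀] at e1
  rw [if_pos hc₀] at e2
  exact_mod_cast e1.symm.trans e2

/-- … hence equal root multisets. [this file] -/
theorem roots_eq_of_prod_aeval_eq (hm : 3 ≤ m) {S : Finset (Fin 3 → Fin (qOf m))}
    {f g : (Fin 3 → Fin (qOf m)) → ℂ[X]} (hf : ∀ c ∈ S, f c ≠ 0) (hg : ∀ c ∈ S, g c ≠ 0)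
    (h : ∏ c ∈ S, Polynomial.aeval (kiPer m c) (f c) = ∏ c ∈ S, Polynomial.aeval (kiPer m c) (g c))
    {c₀ : Fin 3 → Fin (qOf m)} (hc₀ : c₀ ∈ S) : (f c₀).roots = (g c₀).roots := by
  classical
  refine Multiset.ext.2 fun a => ?_
  rw [Polynomial.count_roots, Polynomial.count_roots]
  exact rootMultiplicity_eq_of_prod_aeval_eq hm hf hg h hc₀ a

/-- A product of univariates evaluated anywhere = (product of leading coefficients) · (product of root products). [folklore] -/
theorem prod_aeval_eq_prod_leadingCoeff_mul {A : Type*} [CommRing A] [Algebra ℂ A] (S : Finset (Fin 3 → Fin (qOf m)))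
    (x : (Fin 3 → Fin (qOf m)) → A) (f : (Fin 3 → Fin (qOf m)) → ℂ[X]) :
    ∏ c ∈ S, Polynomial.aeval (x c) (f c) =
      algebraMap ℂ A (∏ c ∈ S, (f c).leadingCoeff) *
        ∏ c ∈ S, Polynomial.aeval (x c) ((f c).roots.map fun a => Polynomial.X - Polynomial.C a).prod := by
  rw [map_prod, ← Finset.prod_mul_distrib]
  refine Finset.prod_congr rfl fun c _ => ?_
  conv_lhs => rw [← C_leadingCoeff_mul_rootsProd (f c)]
  rw [map_mul, Polynomial.aeval_C]

/-- **Main lemma**: if `∏_c f_c(P_c) = ∏_c g_c(P_c)` in `ℂ[y]` with all `f_c, g_c ≠ 0`, then already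
`∏_c f_c(z_c) = ∏_c g_c(z_c)` as polynomials in the block variables (`m ≥ 3`). [this file] -/
theorem prod_aeval_X_eq_of_prod_aeval_kiPer_eq (hm : 3 ≤ m) {S : Finset (Fin 3 → Fin (qOf m))}
    {f g : (Fin 3 → Fin (qOf m)) → ℂ[X]} (hf : ∀ c ∈ S, f c ≠ 0) (hg : ∀ c ∈ S, g c ≠ 0)
    (h : ∏ c ∈ S, Polynomial.aeval (kiPer m c) (f c) = ∏ c ∈ S, Polynomial.aeval (kiPer m c) (g c)) :
    ∏ c ∈ S, Polynomial.aeval (X c : MvPolynomial (Fin 3 → Fin (qOf m)) ℂ) (f c) =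
      ∏ c ∈ S, Polynomial.aeval (X c : MvPolynomial (Fin 3 → Fin (qOf m)) ℂ) (g c) := by
  classical
  have h1 : 1 ≤ m := by omega
  have hroots : ∀ c ∈ S, (f c).roots = (g c).roots := fun c hc => roots_eq_of_prod_aeval_eq hm hf hg h hc
  -- the root products agree
  have hR : ∀ {A : Type} [CommRing A] [Algebra ℂ A] (x : (Fin 3 → Fin (qOf m)) → A),
      ∏ c ∈ S, Polynomial.aeval (x c) ((f c).roots.map fun a => Polynomial.X - Polynomial.C a).prod =
        ∏ c ∈ S, Polynomial.aeval (x c) ((g c).roots.map fun a => Polynomial.X - Polynomial.C a).prod := by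
    intro A _ _ x
    exact Finset.prod_congr rfl fun c hc => by rw [hroots c hc]
  -- the leading-coefficient products agree (cancel the nonzero root product in `ℂ[y]`)
  have hQ : ∏ c ∈ S, Polynomial.aeval (kiPer m c) ((g c).roots.map fun a => Polynomial.X - Polynomial.C a).prod ≠ 0 := by
    rw [Finset.prod_ne_zero_iff]
    intro c _ h0
    exact (Polynomial.monic_multisetProd_X_sub_C (g c).roots).ne_zero ((aeval_kiPer_eq_zero_iff h1 c _).1 h0)
  have hlead : ∏ c ∈ S, (f c).leadingCoeff = ∏ c ∈ S, (g c).leadingCoeff := by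
    have e := h
    rw [prod_aeval_eq_prod_leadingCoeff_mul S (kiPer m) f, prod_aeval_eq_prod_leadingCoeff_mul S (kiPer m) g,
      hR (kiPer m)] at e
    have e' := mul_right_cancel₀ hQ e
    rw [MvPolynomial.algebraMap_eq] at e'
    exact (C_injective _ _) e'
  rw [prod_aeval_eq_prod_leadingCoeff_mul S X f, prod_aeval_eq_prod_leadingCoeff_mul S X g, hlead, hR X]

/-- `D ↦ D(G_m)` on a product of univariates in the block variables. [this file] -/
theorem bind₁_kiPer_prod_aeval_X (S : Finset (Fin 3 → Fin (qOf m))) (u : (Fin 3 → Fin (qOf m)) → ℂ[X]) :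
    bind₁ (kiPer m) (∏ c ∈ S, Polynomial.aeval (X c : MvPolynomial (Fin 3 → Fin (qOf m)) ℂ) (u c)) =
      ∏ c ∈ S, Polynomial.aeval (kiPer m c) (u c) := by
  rw [map_prod]
  refine Finset.prod_congr rfl fun c _ => ?_
  rw [← Polynomial.aeval_algHom_apply, bind₁_X_right]

/-- **THE TWO-TERM RUNG** (KERNEL, unconditional, `m ≥ 3`, NO degree / support / size hypothesis): the planted
Kabanets–Impagliazzo permanent generator `G_m` hits every nonzero difference of two products of univariate polynomials in
the block variables, `D = ∏_{c ∈ S} f_c(z_c) − ∏_{c ∈ S} g_c(z_c)` — i.e. every nonzero `Σ^{[2]}Π`-univariate polynomial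
(the commutative width-2 read-once oblivious ABPs, in any order of the `q³` variables). Proof: unique factorisation in `ℂ[y]`
at the pairwise non-associated primes `P_c − α`. [this file] -/
theorem kiPer_hits_prod_sub_prod (hm : 3 ≤ m) (S : Finset (Fin 3 → Fin (qOf m)))
    (f g : (Fin 3 → Fin (qOf m)) → ℂ[X])
    (hD : (∏ c ∈ S, Polynomial.aeval (X c : MvPolynomial (Fin 3 → Fin (qOf m)) ℂ) (f c)) -
      (∏ c ∈ S, Polynomial.aeval (X c : MvPolynomial (Fin 3 → Fin (qOf m)) ℂ) (g c)) ≠ 0) :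
    bind₁ (kiPer m) ((∏ c ∈ S, Polynomial.aeval (X c : MvPolynomial (Fin 3 → Fin (qOf m)) ℂ) (f c)) -
      (∏ c ∈ S, Polynomial.aeval (X c : MvPolynomial (Fin 3 → Fin (qOf m)) ℂ) (g c))) ≠ 0 := by
  classical
  have h1 : 1 ≤ m := by omega
  intro h0
  rw [map_sub, bind₁_kiPer_prod_aeval_X, bind₁_kiPer_prod_aeval_X, sub_eq_zero] at h0
  apply hD
  rw [sub_eq_zero]
  by_cases hf : ∀ c ∈ S, f c ≠ 0
  · by_cases hg : ∀ c ∈ S, g c ≠ 0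
    · exact prod_aeval_X_eq_of_prod_aeval_kiPer_eq hm hf hg h0
    · push Not at hg
      obtain ⟨c₁, hc₁, hgc₁⟩ := hg
      have hz : ∏ c ∈ S, Polynomial.aeval (kiPer m c) (g c) = 0 :=
        Finset.prod_eq_zero hc₁ (by rw [hgc₁, map_zero])
      rw [hz, Finset.prod_eq_zero_iff] at h0
      obtain ⟨c₂, hc₂, hfc₂⟩ := h0
      exact absurd ((aeval_kiPer_eq_zero_iff h1 c₂ _).1 hfc₂) (hf c₂ hc₂)
  · push Not at hf
    obtain ⟨c₁, hc₁, hfc₁⟩ := hf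
    have hz : ∏ c ∈ S, Polynomial.aeval (kiPer m c) (f c) = 0 :=
      Finset.prod_eq_zero hc₁ (by rw [hfc₁, map_zero])
    rw [hz, eq_comm, Finset.prod_eq_zero_iff] at h0
    obtain ⟨c₂, hc₂, hgc₂⟩ := h0
    have hg2 : g c₂ = 0 := (aeval_kiPer_eq_zero_iff h1 c₂ _).1 hgc₂
    rw [Finset.prod_eq_zero hc₁ (by rw [hfc₁, map_zero]), Finset.prod_eq_zero hc₂ (by rw [hg2, map_zero])]

/-- **Sum form**: `G_m` hits every nonzero SUM of two products of univariates (`Σ^{[2]}Π`-univariate). [this file] -/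
theorem kiPer_hits_prod_add_prod (hm : 3 ≤ m) (S : Finset (Fin 3 → Fin (qOf m)))
    (f g : (Fin 3 → Fin (qOf m)) → ℂ[X])
    (hD : (∏ c ∈ S, Polynomial.aeval (X c : MvPolynomial (Fin 3 → Fin (qOf m)) ℂ) (f c)) +
      (∏ c ∈ S, Polynomial.aeval (X c : MvPolynomial (Fin 3 → Fin (qOf m)) ℂ) (g c)) ≠ 0) :
    bind₁ (kiPer m) ((∏ c ∈ S, Polynomial.aeval (X c : MvPolynomial (Fin 3 → Fin (qOf m)) ℂ) (f c)) +
      (∏ c ∈ S, Polynomial.aeval (X c : MvPolynomial (Fin 3 → Fin (qOf m)) ℂ) (g c))) ≠ 0 := by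
  classical
  by_cases hS : S = ∅
  · subst hS
    intro h0
    rw [Finset.prod_empty, Finset.prod_empty, map_add, map_one] at h0
    norm_num at h0
  obtain ⟨c₁, hc₁⟩ := Finset.nonempty_iff_ne_empty.2 hS
  -- flip the sign of one univariate: `∏ g = −∏ g'` with `g' = g` except `g' c₁ = −g c₁`
  set g' : (Fin 3 → Fin (qOf m)) → ℂ[X] := Function.update g c₁ (-g c₁) with hg'
  have hflip : ∀ {A : Type} [CommRing A] [Algebra ℂ A] (x : (Fin 3 → Fin (qOf m)) → A),
      ∏ c ∈ S, Polynomial.aeval (x c) (g c) = -∏ c ∈ S, Polynomial.aeval (x c) (g' c) := by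
    intro A _ _ x
    rw [← Finset.mul_prod_erase S _ hc₁, ← Finset.mul_prod_erase S (fun c => Polynomial.aeval (x c) (g' c)) hc₁]
    have e1 : Polynomial.aeval (x c₁) (g' c₁) = -Polynomial.aeval (x c₁) (g c₁) := by
      rw [hg', Function.update_self, map_neg]
    have e2 : ∏ c ∈ S.erase c₁, Polynomial.aeval (x c) (g' c) = ∏ c ∈ S.erase c₁, Polynomial.aeval (x c) (g c) :=
      Finset.prod_congr rfl fun c hc => by rw [hg', Function.update_of_ne (Finset.ne_of_mem_erase hc)]
    rw [e1, e2, neg_mul, neg_neg]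
  have key := kiPer_hits_prod_sub_prod hm S f g' (by
    rw [sub_eq_add_neg, ← hflip X]
    exact hD)
  rw [sub_eq_add_neg, ← hflip X] at key
  exact key

/-! ## 3. Corollaries: no binomial annihilators; every annihilator has at least three terms -/

/-- A monomial as a product of univariates over any block set containing its support. [folklore] -/
theorem monomial_eq_prod_aeval_X {S : Finset (Fin 3 → Fin (qOf m))} {κ : (Fin 3 → Fin (qOf m)) →₀ ℕ}
    (hκ : κ.support ⊆ S) {c₁ : Fin 3 → Fin (qOf m)} (hc₁ : c₁ ∈ S) (a : ℂ) :
    monomial κ a = ∏ c ∈ S, Polynomial.aeval (X c : MvPolynomial (Fin 3 → Fin (qOf m)) ℂ)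
      ((if c = c₁ then Polynomial.C a else 1) * Polynomial.X ^ κ c) := by
  classical
  have e : ∀ c ∈ S, Polynomial.aeval (X c : MvPolynomial (Fin 3 → Fin (qOf m)) ℂ)
      ((if c = c₁ then Polynomial.C a else 1) * Polynomial.X ^ κ c) =
      (if c = c₁ then C a else 1) * X c ^ κ c := by
    intro c _
    rw [map_mul, map_pow, Polynomial.aeval_X]
    congr 1
    split_ifs
    · rw [Polynomial.aeval_C, MvPolynomial.algebraMap_eq]
    · rw [map_one]
  rw [Finset.prod_congr rfl e, Finset.prod_mul_distrib, Finset.prod_ite_eq' S c₁, if_pos hc₁,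
    monomial_eq, Finsupp.prod_of_support_subset κ hκ (fun c e => X c ^ e) fun c _ => pow_zero _]

/-- **No binomial annihilates `G_m`** (`m ≥ 3`): a nonzero `a·z^κ − b·z^{κ'}` is hit, whatever the exponents. Hence the
annihilator ideal of `G_m` contains no binomial — no toric relation among the block permanents. [this file] -/
theorem kiPer_hits_binomial (hm : 3 ≤ m) (κ κ' : (Fin 3 → Fin (qOf m)) →₀ ℕ) (a b : ℂ)
    (hD : (monomial κ a - monomial κ' b : MvPolynomial (Fin 3 → Fin (qOf m)) ℂ) ≠ 0) :
    bind₁ (kiPer m) (monomial κ a - monomial κ' b) ≠ 0 := by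
  classical
  set S := κ.support ∪ κ'.support with hS
  by_cases hSe : S = ∅
  · have hκ : κ = 0 := by
      rw [← Finsupp.support_eq_empty, ← Finset.subset_empty, ← hSe]; exact Finset.subset_union_left
    have hκ' : κ' = 0 := by
      rw [← Finsupp.support_eq_empty, ← Finset.subset_empty, ← hSe]; exact Finset.subset_union_right
    rw [hκ, hκ'] at hD ⊢
    intro h0
    apply hD
    rw [← C_apply, ← C_apply, ← map_sub] at h0 ⊢
    rw [bind₁_C_right, C_eq_zero] at h0
    rw [C_eq_zero]
    exact h0
  obtain ⟨c₁, hc₁⟩ := Finset.nonempty_iff_ne_empty.2 hSe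
  rw [monomial_eq_prod_aeval_X (Finset.subset_union_left : κ.support ⊆ S) hc₁ a,
    monomial_eq_prod_aeval_X (Finset.subset_union_right : κ'.support ⊆ S) hc₁ b] at hD ⊢
  exact kiPer_hits_prod_sub_prod hm S _ _ hD

/-- **Every annihilator of `G_m` has at least three monomials** (`m ≥ 3`; no degree bound). Sharp in `m`: at `m = 2`
the second differences `P_a − P_b − P_c + P_d` vanish (route folder instrument, 80 linear relations). [this file] -/
theorem three_le_card_support_of_annihilator (hm : 3 ≤ m) {D : MvPolynomial (Fin 3 → Fin (qOf m)) ℂ} (hD : D ≠ 0)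
    (h0 : bind₁ (kiPer m) D = 0) : 3 ≤ D.support.card := by
  classical
  by_contra hlt
  push Not at hlt
  have hcard : D.support.card = 1 ∨ D.support.card = 2 := by
    have hpos : 0 < D.support.card := Finset.card_pos.2 (support_nonempty.2 hD)
    omega
  -- write `D` as a binomial `a·z^κ − b·z^{κ'}`
  obtain ⟨κ, κ', a, b, hDeq⟩ : ∃ κ κ' : (Fin 3 → Fin (qOf m)) →₀ ℕ, ∃ a b : ℂ,
      D = monomial κ a - monomial κ' b := by
    rcases hcard with h1 | h2
    · obtain ⟨κ, hκ⟩ := Finset.card_eq_one.1 h1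
      refine ⟨κ, κ, coeff κ D, 0, ?_⟩
      rw [monomial_zero, sub_zero]
      conv_lhs => rw [D.as_sum, hκ, Finset.sum_singleton]
    · obtain ⟨κ, κ', hne, hκ⟩ := Finset.card_eq_two.1 h2
      refine ⟨κ, κ', coeff κ D, -coeff κ' D, ?_⟩
      rw [map_neg, sub_neg_eq_add]
      conv_lhs => rw [D.as_sum, hκ, Finset.sum_pair hne]
  rw [hDeq] at hD h0
  exact kiPer_hits_binomial hm κ κ' a b hD h0

end Summit.ValiantsHypothesis.ValiantsHypothesis.Theorems.DefinabilityGapTwoTermRung
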